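import Summits.BirchSwinnertonDyer.Rank1Residual.X2.CpIntSeriesCongruenceLimit
import HarnessLib

/-!
# Line «crystal» of crux 4 `BSDpOnCellC` (stmt-BirchSwinnertonDyer-19034), §K as TREE THEOREMS — the KERNEL: an ideal congruence modulo `p` in
# `𝓞_{ℂ_p}⟦T⟧` transports the FIRST UNIT COEFFICIENT (index-preserving: it carries `λ` together with `μ = 0`)
# (cell `bsd-eis`; mathematics and Lean text by ideator bsd-idea-12 g12/g14, `Cruxes/BSDpOnCellC/Lines/crystal.lean` v1 §K, sorry-free there;
# landed under `Theorems/` by the LEAD cruxlead-19034 g0 so that it is importable; `--supports stmt-BirchSwinnertonDyer-19034`; namespace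
# `…Cruxes.BSDpOnCellC.Crystal.Kernel` ↦ `…Theorems.CrystalKernel`, text otherwise VERBATIM)

HONEST FRAMING (run/shared/lean/pub/bsd-eis/): pure commutative algebra in `𝓞_{ℂ_p}⟦T⟧` (ultrametric estimates on Cauchy products); the `m = 1`
companion of the tree's `X2/CpIntSeriesCongruenceLimit.lean`; 0 defs, 0 named facts, 0 sorry; nothing about any curve, `L`-function or Selmer
group is asserted; 0 cells / labels / tiers move. THE MOVE (Emerton–Pollack–Weston): Iwasawa invariants are read off along a congruence —
`firstUnitCoeffAt_of_span_sup_eq`: if `(Q) + (p) = (G) + (p)` and `G` has its first unit coefficient at `n`, so does `Q` (no residue field, no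
Weierstrass preparation). Consumers: the registered skeleton's `muFrame_of_…` (μ transport), `han_of_…` / `hanSplitLight_of_…` (λ transport).

References: [Washington1997] §7.1; [EmertonPollackWeston2006] Thm. 1 (the move: invariants along a congruence); cell `Lines/crystal.md` (§K), critic
idea-crit-14 V77/V89 (PASS).
-/

set_option autoImplicit false
set_option linter.dupNamespace false

noncomputable section

open scoped Classical

open PowerSeries

namespace Summit.BirchSwinnertonDyer.BirchSwinnertonDyer.Theorems.CrystalKernel


open Summit.BirchSwinnertonDyer.Rank1Residual.X2.CpIntSeries (norm_sum_lt coe_coeff_mul norm_coeff_le_one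
  exists_firstUnitCoeffAt_of_exists_le norm_coeff_C_pow_mul_le)

variable {p : ℕ} [Fact p.Prime]

/-- If every coefficient of `Q` of index `≤ n` has norm `< 1`, so does the `n`-th coefficient of `A · Q`
(ultrametric inequality on the Cauchy product). [cite: Washington1997, §7.1] -/
theorem norm_coeff_mul_lt_one_of_forall_le (A Q : PowerSeries 𝓞_ℂ_[p]) {n : ℕ}
    (h : ∀ j ≤ n, ‖((coeff j Q : 𝓞_ℂ_[p]) : ℂ_[p])‖ < 1) :
    ‖((coeff n (A * Q) : 𝓞_ℂ_[p]) : ℂ_[p])‖ < 1 := by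
  rw [coe_coeff_mul]
  refine norm_sum_lt _ one_pos fun x hx ↦ ?_
  rw [Finset.HasAntidiagonal.mem_antidiagonal] at hx
  rw [norm_mul]
  calc ‖((coeff x.1 A : 𝓞_ℂ_[p]) : ℂ_[p])‖ * ‖((coeff x.2 Q : 𝓞_ℂ_[p]) : ℂ_[p])‖
      ≤ ‖((coeff x.2 Q : 𝓞_ℂ_[p]) : ℂ_[p])‖ :=
        mul_le_of_le_one_left (norm_nonneg _) (norm_coeff_le_one A x.1)
    _ < 1 := h x.2 (by omega)

/-- Every coefficient of `p · R` has norm `< 1` in `𝓞_{ℂ_p}⟦T⟧`. [folklore] -/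
theorem norm_coeff_C_p_mul_lt_one (R : PowerSeries 𝓞_ℂ_[p]) (j : ℕ) :
    ‖((coeff j (C ((p : ℕ) : 𝓞_ℂ_[p]) * R) : 𝓞_ℂ_[p]) : ℂ_[p])‖ < 1 := by
  have h := norm_coeff_C_pow_mul_le (p := p) R 1 j
  simp only [pow_one] at h
  exact h.trans_lt (inv_lt_one_of_one_lt₀ (by exact_mod_cast (Fact.out : p.Prime).one_lt))

/-- Unpacking `G ∈ (Q) + (p)`: `G = A·Q + p·R`. [folklore] -/
theorem exists_eq_mul_add_of_mem_sup {Q G : PowerSeries 𝓞_ℂ_[p]}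
    (h : G ∈ Ideal.span {Q} ⊔ Ideal.span {(C ((p : ℕ) : 𝓞_ℂ_[p]) : PowerSeries 𝓞_ℂ_[p])}) :
    ∃ A R : PowerSeries 𝓞_ℂ_[p], G = A * Q + C ((p : ℕ) : 𝓞_ℂ_[p]) * R := by
  obtain ⟨x, hx, y, hy, hxy⟩ := Submodule.mem_sup.mp h
  obtain ⟨A, rfl⟩ := Ideal.mem_span_singleton'.mp hx
  obtain ⟨R, rfl⟩ := Ideal.mem_span_singleton'.mp hy
  exact ⟨A, R, by rw [← hxy]; ring⟩

/-- **KERNEL LEMMA (the transport), residual currency.** If `G = A·Q + S` and `Q = A'·G + S'` with `S`, `S'`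
coefficientwise of norm `< 1` (i.e. `G` and `Q` generate the same ideal modulo the maximal ideal — the currency of
Emerton–Pollack–Weston), and `G` has its FIRST UNIT COEFFICIENT at `n` (`μ(G) = 0`, `λ(G) = n` in the wide
receptacle), then `Q` has its first unit coefficient at the SAME index `n`. Proof: `Q = A'·G + S'` makes the
coefficients of `Q` below `n` small; if the `n`-th were small too, `G = A·Q + S` would have a small `n`-th
coefficient. No residue field, no Weierstrass preparation.
[cite: Washington1997, §7.1] [cite: EmertonPollackWeston2006, Thm. 1 (the move: invariants along a congruence)] -/
theorem firstUnitCoeffAt_of_sub_small {Q G A A' S S' : PowerSeries 𝓞_ℂ_[p]} {n : ℕ}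
    (hGeq : G = A * Q + S) (hQeq : Q = A' * G + S')
    (hS : ∀ j, ‖((coeff j S : 𝓞_ℂ_[p]) : ℂ_[p])‖ < 1) (hS' : ∀ j, ‖((coeff j S' : 𝓞_ℂ_[p]) : ℂ_[p])‖ < 1)
    (hG : ‖((coeff n G : 𝓞_ℂ_[p]) : ℂ_[p])‖ = 1 ∧ ∀ i < n, ‖((coeff i G : 𝓞_ℂ_[p]) : ℂ_[p])‖ < 1) :
    ‖((coeff n Q : 𝓞_ℂ_[p]) : ℂ_[p])‖ = 1 ∧ ∀ i < n, ‖((coeff i Q : 𝓞_ℂ_[p]) : ℂ_[p])‖ < 1 := by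
  -- (i) the coefficients of `Q` below `n` are small
  have hlow : ∀ i < n, ‖((coeff i Q : 𝓞_ℂ_[p]) : ℂ_[p])‖ < 1 := by
    intro i hi
    rw [hQeq, map_add]
    push_cast
    exact (IsUltrametricDist.norm_add_le_max _ _).trans_lt (max_lt
      (norm_coeff_mul_lt_one_of_forall_le A' G fun j hj ↦ hG.2 j (lt_of_le_of_lt hj hi)) (hS' i))
  refine ⟨?_, hlow⟩
  -- (ii) the `n`-th coefficient of `Q` is a unit: otherwise `G = A·Q + S` has a small `n`-th coefficient
  by_contra hne
  have hn : ‖((coeff n Q : 𝓞_ℂ_[p]) : ℂ_[p])‖ < 1 := lt_of_le_of_ne (norm_coeff_le_one Q n) hne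
  have hall : ∀ j ≤ n, ‖((coeff j Q : 𝓞_ℂ_[p]) : ℂ_[p])‖ < 1 := by
    intro j hj
    rcases Nat.lt_or_eq_of_le hj with hj' | rfl
    · exact hlow j hj'
    · exact hn
  have hsmall : ‖((coeff n G : 𝓞_ℂ_[p]) : ℂ_[p])‖ < 1 := by
    rw [hGeq, map_add]
    push_cast
    exact (IsUltrametricDist.norm_add_le_max _ _).trans_lt (max_lt
      (norm_coeff_mul_lt_one_of_forall_le A Q hall) (hS n))
  exact hsmall.ne hG.1

/-- **KERNEL LEMMA, `m = 1` ideal currency** (the cell's: erratum (c) / road H (b)♭ at `m = 1`). If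
`(G) + (p) = (Q) + (p)` as ideals of `𝓞_{ℂ_p}⟦T⟧` and `G` has its first unit coefficient at `n`, then so does `Q`,
at the same index. (Unpack both memberships as `A·(−) + p·R` and apply `firstUnitCoeffAt_of_sub_small`.)
[cite: Washington1997, §7.1] -/
theorem firstUnitCoeffAt_of_span_sup_eq {Q G : PowerSeries 𝓞_ℂ_[p]} {n : ℕ}
    (h : Ideal.span {G} ⊔ Ideal.span {(C ((p : ℕ) : 𝓞_ℂ_[p]) : PowerSeries 𝓞_ℂ_[p])} =
      Ideal.span {Q} ⊔ Ideal.span {(C ((p : ℕ) : 𝓞_ℂ_[p]) : PowerSeries 𝓞_ℂ_[p])})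
    (hG : ‖((coeff n G : 𝓞_ℂ_[p]) : ℂ_[p])‖ = 1 ∧ ∀ i < n, ‖((coeff i G : 𝓞_ℂ_[p]) : ℂ_[p])‖ < 1) :
    ‖((coeff n Q : 𝓞_ℂ_[p]) : ℂ_[p])‖ = 1 ∧ ∀ i < n, ‖((coeff i Q : 𝓞_ℂ_[p]) : ℂ_[p])‖ < 1 := by
  have hGmem : G ∈ Ideal.span {Q} ⊔ Ideal.span {(C ((p : ℕ) : 𝓞_ℂ_[p]) : PowerSeries 𝓞_ℂ_[p])} := by
    have hG' : G ∈ Ideal.span {G} ⊔ Ideal.span {(C ((p : ℕ) : 𝓞_ℂ_[p]) : PowerSeries 𝓞_ℂ_[p])} :=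
      Ideal.mem_sup_left (Ideal.mem_span_singleton_self G)
    rwa [h] at hG'
  have hQmem : Q ∈ Ideal.span {G} ⊔ Ideal.span {(C ((p : ℕ) : 𝓞_ℂ_[p]) : PowerSeries 𝓞_ℂ_[p])} := by
    have hQ' : Q ∈ Ideal.span {Q} ⊔ Ideal.span {(C ((p : ℕ) : 𝓞_ℂ_[p]) : PowerSeries 𝓞_ℂ_[p])} :=
      Ideal.mem_sup_left (Ideal.mem_span_singleton_self Q)
    rwa [← h] at hQ'
  obtain ⟨A, R, hGeq⟩ := exists_eq_mul_add_of_mem_sup hGmem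
  obtain ⟨A', R', hQeq⟩ := exists_eq_mul_add_of_mem_sup hQmem
  exact firstUnitCoeffAt_of_sub_small hGeq hQeq (norm_coeff_C_p_mul_lt_one R) (norm_coeff_C_p_mul_lt_one R') hG

/-- If `Q · P` has a first unit coefficient (at `n`), then `Q` has one (at some index `≤ n`): otherwise all
coefficients of `Q` up to `n` are small and so is the `n`-th coefficient of `P · Q`. [cite: Washington1997, §7.1] -/
theorem exists_firstUnitCoeffAt_of_mul {Q P : PowerSeries 𝓞_ℂ_[p]} {n : ℕ}
    (h : ‖((coeff n (Q * P) : 𝓞_ℂ_[p]) : ℂ_[p])‖ = 1 ∧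
      ∀ i < n, ‖((coeff i (Q * P) : 𝓞_ℂ_[p]) : ℂ_[p])‖ < 1) :
    ∃ m ≤ n, ‖((coeff m Q : 𝓞_ℂ_[p]) : ℂ_[p])‖ = 1 ∧ ∀ i < m, ‖((coeff i Q : 𝓞_ℂ_[p]) : ℂ_[p])‖ < 1 := by
  refine exists_firstUnitCoeffAt_of_exists_le ?_
  by_contra hc
  push Not at hc
  have hsmall : ‖((coeff n (Q * P) : 𝓞_ℂ_[p]) : ℂ_[p])‖ < 1 := by
    rw [mul_comm]
    exact norm_coeff_mul_lt_one_of_forall_le P Q hc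
  exact hsmall.ne h.1

/-- **`λ`-form of the transport (for the LEAD; information).** Under `(G) + (p) = (Q·P) + (p)`, a first unit
coefficient of `G` at `n` and one of `P` at `b` force one of `Q` at `n − b` (indices add: `λ(Q) + λ(P) = λ(G)`).
[cite: Washington1997, §7.1] -/
theorem firstUnitCoeffAt_left_of_span_sup_eq_mul {Q P G : PowerSeries 𝓞_ℂ_[p]} {n b : ℕ}
    (h : Ideal.span {G} ⊔ Ideal.span {(C ((p : ℕ) : 𝓞_ℂ_[p]) : PowerSeries 𝓞_ℂ_[p])} =
      Ideal.span {Q * P} ⊔ Ideal.span {(C ((p : ℕ) : 𝓞_ℂ_[p]) : PowerSeries 𝓞_ℂ_[p])})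
    (hG : ‖((coeff n G : 𝓞_ℂ_[p]) : ℂ_[p])‖ = 1 ∧ ∀ i < n, ‖((coeff i G : 𝓞_ℂ_[p]) : ℂ_[p])‖ < 1)
    (hP : ‖((coeff b P : 𝓞_ℂ_[p]) : ℂ_[p])‖ = 1 ∧ ∀ i < b, ‖((coeff i P : 𝓞_ℂ_[p]) : ℂ_[p])‖ < 1) :
    ∃ a, (‖((coeff a Q : 𝓞_ℂ_[p]) : ℂ_[p])‖ = 1 ∧ ∀ i < a, ‖((coeff i Q : 𝓞_ℂ_[p]) : ℂ_[p])‖ < 1) ∧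
      b + a = n := by
  have hQP := firstUnitCoeffAt_of_span_sup_eq h hG
  rw [mul_comm] at hQP
  exact Summit.BirchSwinnertonDyer.Rank1Residual.X2.CpIntSeries.exists_firstUnitCoeffAt_right hP hQP

end Summit.BirchSwinnertonDyer.BirchSwinnertonDyer.Theorems.CrystalKernel

end
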